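import Literature.AlgebraicGeometry.AbelianSchemes.AbelianSchemeOverIsMonHomLocal
import Literature.AlgebraicGeometry.Morphisms.ClopenPieceOfCoproduct
import HarnessLib

/-!
# Gluing homomorphisms of abelian schemes over a DISJOINT open cover of the base (pieces of a coproduct decomposition)
# ([GortzWedhorn2020] §(3.3) Prop. 3.5 (gluing of morphisms), §(3.5) Ex. 3.11 (disjoint unions), §(4.15) (homomorphisms are local))

Topic `Literature/AlgebraicGeometry/AbelianSchemes`, namespace `Literature.AlgebraicGeometry.AbelianSchemes.AbelianSchemeOver`.
THEOREMS ONLY (no definition, no named fact, no instance, no notation, no `sorry`).  Cell `hodgecm-mathlib` (D-0151), FLOOR 0, P6 «MOD»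
(crux hLiu418 = stmt-HodgeConjecture-24832, `--supports`), organ **ASM (b) «GLUE OVER THE PIECES»** of the E6 closer of
`Cruxes/HLiu418/Lines/F0_P6a_PELWitnessE.lean` (socket Σ-AN `ReadsCReading`, E6 heir A-p06 (g33), census `CENSUS-SigmaAN.v1` row ASM): the complexified
record curve `X_ℂ` is the disjoint union of its ball-quotient pieces `X_q` (★ `RecordSystemGS.pieces`, a colimit cofan), the endomorphism `Y_q b` of the
pulled-back universal family is produced PIECE BY PIECE (★ P-3 + ★ E6-an′ `exists_isMonHom_of_chartReadings`), and this file glues the `Y_q b` to ONE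
endomorphism of `P.A ×_X X_ℂ`.  HC_CM is proved only modulo the printed citations (2 remaining named inputs hLiu418 24832, h413 24833) until rung 0
closes; this file is generic and changes no count.

THE MATHEMATICS.  `A, B` abelian schemes over `S`, `(U_i → S)_i` an open cover with PAIRWISE DISJOINT images (the legs of a coproduct decomposition,
★ `Morphisms.pairwise_disjoint_range_of_isColimit_cofan` ∕ `isOpenImmersion_of_isColimit_cofan`), and `S|_{U_i}`-homomorphisms `Y_i : A ×_S U_i → B ×_S U_i`.
The open cover `(A ×_S U_i → A)_i` of the total space has EMPTY pairwise overlaps for `i ≠ j` (they lie over `U_i ∩ U_j = ∅`) and for `i = j` the two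
projections of the self-overlap agree (an open immersion is a monomorphism), so Mathlib's `Scheme.Cover.glueMorphisms` applies with no compatibility to
check: there is ONE `S`-morphism `f : A → B` with `f ×_S U_i = Y_i` for all `i` (§2), unique (★ `hom_ext_pullback_openCover`), and a homomorphism because
being one is Zariski-local on the base (★ `isMonHom_of_openCover`, [GortzWedhorn2020] §(4.15)).

* §1 `isEmpty_pullback_of_disjoint` — overlaps of total-space pieces over disjoint base pieces are empty; `glue_compat` — the (automatic)
  compatibility of any recipes on the pieces.
* §2 **`exists_hom_of_disjoint_openCover`** — THE HEAD: `∃ f : A.X ⟶ B.X, IsMonHom f ∧ ∀ i, (Over.pullback (𝒰.f i)).map f = Y i`;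
  `hom_unique_of_openCover` — uniqueness (any open cover).
* §3 (ED. 2) **`exists_hom_of_isColimit_cofan`** — COFAN FORM: the pieces given as the legs `ι_i : U_i ⟶ S` of a colimit cofan (★
  `Morphisms.isOpenImmersion_of_isColimit_cofan` ∕ `pairwise_disjoint_range_of_isColimit_cofan` ∕ `exists_eq_of_isColimit_cofan` make them a disjoint open cover).

## References
* [GortzWedhorn2020] U. Görtz, T. Wedhorn, *Algebraic Geometry I*, 2nd ed. (2020), §(3.3) Proposition 3.5 (gluing of morphisms), §(3.5) Proposition 3.10 and
  Example 3.11 (disjoint unions of schemes, p. 73), §(4.15) (p. 116) and Definition 4.42 (homomorphisms of group schemes).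
-/

set_option autoImplicit false

noncomputable section

open CategoryTheory CategoryTheory.Limits AlgebraicGeometry Function

universe u

namespace Literature.AlgebraicGeometry.AbelianSchemes.AbelianSchemeOver

variable {S : Scheme.{u}} (A B : AbelianSchemeOver S) (𝒰 : Scheme.OpenCover.{u} S)

/-! ### §1 Overlaps of the pulled-back cover over disjoint base pieces -/

omit B in
/-- **Over disjoint base pieces the total-space pieces do not meet**: for `U_i(S) ∩ U_j(S) = ∅`, the overlap
`(A ×_S U_i) ×_A (A ×_S U_j)` is EMPTY (a point of it lies over a point of `U_i ∩ U_j`). [cite: GortzWedhorn2020, §(3.5) Proposition 3.10 and Example 3.11 (disjoint union of schemes, p. 73)] -/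
theorem isEmpty_pullback_of_disjoint {i j : 𝒰.I₀} (hij : Disjoint (Set.range (𝒰.f i)) (Set.range (𝒰.f j))) :
    IsEmpty ↥(pullback (pullback.fst A.X.hom (𝒰.f i)) (pullback.fst A.X.hom (𝒰.f j))) := by
  refine ⟨fun p => ?_⟩
  -- the common point of `A` under the two projections, and its images in `S`
  have h1 := congrArg (fun φ => φ p)
    (pullback.condition (f := pullback.fst A.X.hom (𝒰.f i)) (g := pullback.fst A.X.hom (𝒰.f j)))
  have h2 := congrArg (fun φ => φ (pullback.fst (pullback.fst A.X.hom (𝒰.f i)) (pullback.fst A.X.hom (𝒰.f j)) p))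
    (pullback.condition (f := A.X.hom) (g := 𝒰.f i))
  have h3 := congrArg (fun φ => φ (pullback.snd (pullback.fst A.X.hom (𝒰.f i)) (pullback.fst A.X.hom (𝒰.f j)) p))
    (pullback.condition (f := A.X.hom) (g := 𝒰.f j))
  simp only [Scheme.Hom.comp_apply] at h1 h2 h3
  refine Set.disjoint_left.mp hij ⟨_, h2.symm⟩ ?_
  rw [h1]
  exact ⟨_, h3.symm⟩

omit B in
/-- **The gluing compatibility is automatic on a disjoint cover**: for ANY recipes `g_i : A ×_S U_i → T` the two restrictions to
`(A ×_S U_i) ×_A (A ×_S U_j)` agree — for `i ≠ j` the overlap is empty, for `i = j` the two projections of the self-overlap of the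
MONOMORPHISM `A ×_S U_i → A` coincide (Mathlib `fst_eq_snd_of_mono_eq`). [cite: GortzWedhorn2020, §(3.3) Proposition 3.5] -/
theorem glue_compat (hdisj : Pairwise (Disjoint on fun i => Set.range (𝒰.f i))) {T : Scheme.{u}}
    (g : ∀ i, pullback A.X.hom (𝒰.f i) ⟶ T) (i j : 𝒰.I₀) :
    pullback.fst (pullback.fst A.X.hom (𝒰.f i)) (pullback.fst A.X.hom (𝒰.f j)) ≫ g i =
      pullback.snd (pullback.fst A.X.hom (𝒰.f i)) (pullback.fst A.X.hom (𝒰.f j)) ≫ g j := by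
  classical
  rcases eq_or_ne i j with rfl | hij
  · rw [fst_eq_snd_of_mono_eq]
  · haveI := isEmpty_pullback_of_disjoint A 𝒰 (hdisj hij)
    exact Limits.IsInitial.hom_ext isInitialOfIsEmpty _ _

/-! ### §2 HEAD: gluing homomorphisms given on the pieces -/

/-- **Uniqueness** (any open cover of the base): two `S`-morphisms `A → B` with the same base changes to every `U_i` are equal (★
`hom_ext_pullback_openCover`). [cite: GortzWedhorn2020, §(3.3) Proposition 3.5] -/
theorem hom_unique_of_openCover {f f' : A.X ⟶ B.X} (h : ∀ i, (Over.pullback (𝒰.f i)).map f = (Over.pullback (𝒰.f i)).map f') : f = f' :=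
  hom_ext_pullback_openCover 𝒰 f f' h

/-- **GLUING HOMOMORPHISMS OF ABELIAN SCHEMES OVER A DISJOINT OPEN COVER OF THE BASE** (the pieces of a coproduct decomposition `S = ∐ U_i`):
homomorphisms `Y_i : A ×_S U_i → B ×_S U_i` of the base-changed abelian schemes glue to ONE `S`-homomorphism `f : A → B` with `f ×_S U_i = Y_i` for every `i`
(glue `Y_i ≫ pr_B` on the open cover `(A ×_S U_i)_i` of `A` — compatibility §1 —, read it over `S` and on each `U_i` by the universal property of
`B ×_S U_i`, homomorphism by ★ `isMonHom_of_openCover`).  In E6: `S = X_ℂ`, `U_q` = the ball-quotient pieces, `A = B = P.A ×_X X_ℂ`, `Y_q` = the per-piece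
endomorphism of ★ E6-an′ transported along `P_{X_q}.A ≅ A ×_S X_q`. [cite: GortzWedhorn2020, §(3.3) Proposition 3.5] [cite: GortzWedhorn2020, §(4.15) (p. 116) and Definition 4.42 (p. 116)]
[cite: GortzWedhorn2020, §(3.5) Proposition 3.10 and Example 3.11 (disjoint union of schemes, p. 73)] -/
theorem exists_hom_of_disjoint_openCover (hdisj : Pairwise (Disjoint on fun i => Set.range (𝒰.f i)))
    (Y : ∀ i, (A.baseChange (𝒰.f i)).X ⟶ (B.baseChange (𝒰.f i)).X) [hY : ∀ i, IsMonHom (Y i)] :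
    ∃ f : A.X ⟶ B.X, IsMonHom f ∧ ∀ i, (Over.pullback (𝒰.f i)).map f = Y i := by
  -- clean-typed copies of the data: `y i : A ×_S U_i → B ×_S U_i` over `U_i`
  let y : ∀ i, pullback A.X.hom (𝒰.f i) ⟶ pullback B.X.hom (𝒰.f i) := fun i => (Y i).left
  have hw : ∀ i, y i ≫ pullback.snd B.X.hom (𝒰.f i) = pullback.snd A.X.hom (𝒰.f i) := fun i => Over.w (Y i)
  -- the open cover of the total space of `A` and the recipes on its pieces
  let 𝒱 : Scheme.OpenCover.{u} A.X.left := 𝒰.pullback₁ A.X.hom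
  let g : ∀ i, pullback A.X.hom (𝒰.f i) ⟶ B.X.left := fun i => y i ≫ pullback.fst B.X.hom (𝒰.f i)
  -- glue (compatibility is §1)
  let F : A.X.left ⟶ B.X.left := Scheme.Cover.glueMorphisms 𝒱 g (glue_compat A 𝒰 hdisj g)
  have hF : ∀ i, pullback.fst A.X.hom (𝒰.f i) ≫ F = y i ≫ pullback.fst B.X.hom (𝒰.f i) := fun i =>
    Scheme.Cover.ι_glueMorphisms 𝒱 g (glue_compat A 𝒰 hdisj g) i
  -- `F` lies over `S` (tested on the cover of `A`)
  have hFS : F ≫ B.X.hom = A.X.hom := by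
    refine Scheme.Cover.hom_ext 𝒱 _ _ fun (i : 𝒰.I₀) => ?_
    change pullback.fst A.X.hom (𝒰.f i) ≫ F ≫ B.X.hom = pullback.fst A.X.hom (𝒰.f i) ≫ A.X.hom
    rw [← Category.assoc, hF i, Category.assoc, pullback.condition, ← Category.assoc, hw i, pullback.condition]
  let f : A.X ⟶ B.X := Over.homMk F hFS
  -- `f ×_S U_i = Y_i`
  have hf : ∀ i, (Over.pullback (𝒰.f i)).map f = Y i := by
    intro i
    ext : 1
    apply pullback.hom_ext
    · simp only [Over.pullback_map_left]
      erw [pullback.lift_fst]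
      exact hF i
    · simp only [Over.pullback_map_left]
      erw [pullback.lift_snd]
      exact (hw i).symm
  exact ⟨f, isMonHom_of_openCover A B 𝒰 f fun k => by rw [hf k]; exact hY k, hf⟩

/-! ### §3 (ED. 2) Cofan form: the pieces as the legs of a coproduct decomposition -/

/-- **GLUING HOMOMORPHISMS OVER THE LEGS OF A COLIMIT COFAN** (the form the E6 closer meets: ★ `RecordSystemGS.pieces` is an `IsColimit (Cofan.mk _ ι)`):
for a coproduct decomposition `(ι_i : U_i ⟶ S)_i` of the base and homomorphisms `Y_i : A ×_S U_i → B ×_S U_i`, there is an `S`-homomorphism `f : A → B` with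
`f ×_S U_i = Y_i` for all `i` — the legs are open immersions with pairwise disjoint images covering `S` (★ `Morphisms.isOpenImmersion_of_isColimit_cofan`,
★ `pairwise_disjoint_range_of_isColimit_cofan`, ★ `exists_eq_of_isColimit_cofan`), so §2 applies to the open cover they form (Mathlib `Cover.mkOfCovers`).
[cite: GortzWedhorn2020, §(3.5) Proposition 3.10 and Example 3.11 (disjoint union of schemes, p. 73)] [cite: GortzWedhorn2020, §(3.3) Proposition 3.5]
[cite: GortzWedhorn2020, §(4.15) (p. 116) and Definition 4.42 (p. 116)] -/
theorem exists_hom_of_isColimit_cofan {σ : Type u} {U : σ → Scheme.{u}} {ι : ∀ i, U i ⟶ S} (hc : IsColimit (Cofan.mk S ι))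
    (Y : ∀ i, (A.baseChange (ι i)).X ⟶ (B.baseChange (ι i)).X) [hY : ∀ i, IsMonHom (Y i)] :
    ∃ f : A.X ⟶ B.X, IsMonHom f ∧ ∀ i, (Over.pullback (ι i)).map f = Y i := by
  haveI : ∀ i, IsOpenImmersion (ι i) := fun i => Literature.AlgebraicGeometry.Morphisms.isOpenImmersion_of_isColimit_cofan hc i
  let 𝒱 : Scheme.OpenCover.{u} S :=
    Scheme.Cover.mkOfCovers σ U ι (fun s => Literature.AlgebraicGeometry.Morphisms.exists_eq_of_isColimit_cofan hc s) fun i => inferInstance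
  exact exists_hom_of_disjoint_openCover A B 𝒱 (Literature.AlgebraicGeometry.Morphisms.pairwise_disjoint_range_of_isColimit_cofan hc) Y
    (hY := fun i => hY i)

end Literature.AlgebraicGeometry.AbelianSchemes.AbelianSchemeOver

end
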